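import Mathlib
import HarnessLib
import Literature.Analysis.FluidPDE.SpaceTimeRescaling
import Literature.Analysis.FluidPDE.NecasRuzickaSverakRRS
import Summits.NavierStokesRegularity.NavierStokesRegularity.Theorems.AxisTwistDoorAveragedConeLiouvilleDefs

/-!
# Route `AxisTwistDoor`, crux `AveragedConeLiouville` (stmt-NavierStokesRegularity-26889), line `lrt_shell`, stub (5b)
# — brick H2: AFFINE COVARIANCE of the classical positivity propagation (Lei–Ren–Tian arXiv:2501.08976, remark
# after Lemma 2.5: "The exact choice of domains in Lemma 2.5 can be rather arbitrary")

The Harnack chain of stub (5b) applies the classical positivity propagation `PositivityPropagationFactC` (stated on the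
unit cylinder `(0,T) × B(0,1)`, Defs) on parabolic cylinders `(t₀, t₀ + R²T) × B(x₀, R)` of all sizes.  This file
states that version — `PositivityPropagationAffineC`: SAME constant `β(δ,T,r,Λ)`, drift bound `Λ/R`, occupied measure
`≥ δR³`, conclusion on `(t₀ + R²T/2, t₀ + R²T) × B(x₀, rR)` — and PROVES
`positivityPropagationAffine_of_factC : PositivityPropagationFactC → PositivityPropagationAffineC` by the parabolic
change of variables `V' = stPull R² R t₀ x₀ V` (`V'(τ,y) = V(t₀ + R²τ, x₀ + Ry)`), `b' = R • stPull … b`, under which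
`∂ₜ − Δ + b·∇` is covariant (tree: `timeDeriv_stPull`, `gradient_stPull`, `divergence_const_smul_comp_smul`,
`fderiv_comp_add_left`, and a LOCAL version of `laplacian_stPull` for slices that are `C²` only on an open set — via a
bump function and `laplacian_congr_nhds`), while Lebesgue measure scales by `R³` (`Measure.addHaar_preimage_smul`,
`measure_preimage_add`).

Seat ns-atd-p1 (LEAD). WHAT THIS IS NOT: not a statement about Navier–Stokes regularity; calculus for a STAGED door
route. Lands `--supports` the crux item as a helper.
-/

noncomputable section

-- the summit and its single sub-problem share the name (CONVENTIONS §1), as in every Theorems file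
set_option linter.dupNamespace false

namespace Summit.NavierStokesRegularity.NavierStokesRegularity.Theorems.AxisTwistDoorAveragedConeLiouvillePositivityAffine

open scoped InnerProductSpace ENNReal Laplacian Topology
open Set Function MeasureTheory Metric Filter
open Literature.Analysis
open Literature.Analysis.FluidPDE hiding eR
open Summit.NavierStokesRegularity.NavierStokesRegularity.Theorems.AxisTwistDoorAveragedConeLiouvilleDefs

/-- **Classical positivity propagation on an arbitrary parabolic cylinder** `(t₀, t₀ + R²T) × B(x₀, R)` (`R > 0`),
with the constant `β = β(δ,T,r,Λ)` of the unit cylinder: `V`, `b` of class `C²`/`C¹` on an open neighbourhood `U` of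
the closed cylinder, `|b| ≤ Λ/R`, `div b = 0`, `V ≥ 0`, `∂ₜV − ΔV + b·∇V ≥ 0` on the open cylinder, and
`|{x ∈ B(x₀,R) : V(t̄,x) ≥ λ}| ≥ δR³` at some `t̄ ∈ (t₀, t₀ + R²T/3)` give `V ≥ βλ` on
`(t₀ + R²T/2, t₀ + R²T) × B(x₀, rR)`. -/
def PositivityPropagationAffineC : Prop :=
  ∀ δ T r Λ : ℝ, 0 < δ → 0 < T → 0 < r → r < 1 → 0 ≤ Λ → ∃ β : ℝ, 0 < β ∧
    ∀ (V : ℝ → EuclideanSpace ℝ (Fin 3) → ℝ) (b : ℝ → EuclideanSpace ℝ (Fin 3) → EuclideanSpace ℝ (Fin 3))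
      (U : Set (ℝ × EuclideanSpace ℝ (Fin 3))) (x₀ : EuclideanSpace ℝ (Fin 3)) (t₀ R : ℝ), 0 < R → IsOpen U →
      Set.Icc t₀ (t₀ + R ^ 2 * T) ×ˢ Metric.closedBall x₀ R ⊆ U →
      ContDiffOn ℝ 2 (Function.uncurry V) U → ContDiffOn ℝ 1 (Function.uncurry b) U →
      (∀ t ∈ Set.Ioo t₀ (t₀ + R ^ 2 * T), ∀ x ∈ Metric.ball x₀ R, ‖b t x‖ ≤ Λ / R) →
      (∀ t ∈ Set.Ioo t₀ (t₀ + R ^ 2 * T), ∀ x ∈ Metric.ball x₀ R, VectorCalculus.divergence (b t) x = 0) →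
      (∀ t ∈ Set.Ioo t₀ (t₀ + R ^ 2 * T), ∀ x ∈ Metric.ball x₀ R, 0 ≤ V t x) →
      (∀ t ∈ Set.Ioo t₀ (t₀ + R ^ 2 * T), ∀ x ∈ Metric.ball x₀ R,
          0 ≤ deriv (fun τ => V τ x) t - (Δ (V t)) x + ⟪b t x, gradient (V t) x⟫_ℝ) →
      ∀ tbar lam : ℝ, t₀ < tbar → tbar < t₀ + R ^ 2 * T / 3 → 0 < lam →
        ENNReal.ofReal (δ * R ^ 3) ≤ volume {x : EuclideanSpace ℝ (Fin 3) | x ∈ Metric.ball x₀ R ∧ lam ≤ V tbar x} →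
        ∀ t ∈ Set.Ioo (t₀ + R ^ 2 * T / 2) (t₀ + R ^ 2 * T), ∀ x ∈ Metric.ball x₀ (r * R), β * lam ≤ V t x

/-! ### A `C²` function on an open set agrees near each point with a globally `C²` function -/

/-- Local-to-global: a function `C²` on an open set `W ∋ x` agrees near `x` with a `C²` function on the whole space
(multiply by a smooth bump supported in a closed ball inside `W`). -/
theorem exists_contDiff_eventuallyEq {g : EuclideanSpace ℝ (Fin 3) → ℝ} {W : Set (EuclideanSpace ℝ (Fin 3))}
    (hW : IsOpen W) {x : EuclideanSpace ℝ (Fin 3)} (hx : x ∈ W) (hg : ContDiffOn ℝ 2 g W) :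
    ∃ g' : EuclideanSpace ℝ (Fin 3) → ℝ, ContDiff ℝ 2 g' ∧ g' =ᶠ[𝓝 x] g := by
  obtain ⟨ε, hε, hball⟩ := Metric.isOpen_iff.1 hW x hx
  -- a bump `= 1` on `closedBall x (ε/4)`, supported in `closedBall x (ε/2) ⊆ W`
  let χ : ContDiffBump x := ⟨ε / 4, ε / 2, by positivity, by linarith⟩
  refine ⟨fun y => χ y * g y, ?_, ?_⟩
  · refine contDiff_iff_contDiffAt.2 fun y => ?_
    by_cases hy : y ∈ W
    · exact (χ.contDiff (n := 2)).contDiffAt.mul (hg.contDiffAt (hW.mem_nhds hy))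
    · -- off `W` the product vanishes near `y` (`tsupport χ = closedBall x (ε/2) ⊆ ball x ε ⊆ W`)
      have hy' : y ∉ tsupport (χ : EuclideanSpace ℝ (Fin 3) → ℝ) := by
        rw [χ.tsupport_eq]
        intro h
        exact hy (hball (mem_ball.2 (lt_of_le_of_lt (mem_closedBall.1 h) (by show ε / 2 < ε; linarith))))
      have h0 : (fun y => χ y * g y) =ᶠ[𝓝 y] fun _ => 0 := by
        have := notMem_tsupport_iff_eventuallyEq.1 hy'
        filter_upwards [this] with w hw
        simp [hw]
      exact (contDiffAt_const (c := (0 : ℝ))).congr_of_eventuallyEq h0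
  · have h1 : ∀ᶠ y in 𝓝 x, y ∈ closedBall x (ε / 4) := closedBall_mem_nhds x (by positivity)
    filter_upwards [h1] with y hy
    rw [χ.one_of_mem_closedBall hy, one_mul]

/-- The Laplacian of a pulled-back slice that is `C²` only on an open set: local version of `laplacian_stPull`. -/
theorem laplacian_stPull_of_contDiffOn {V : ℝ → EuclideanSpace ℝ (Fin 3) → ℝ} {W : Set (EuclideanSpace ℝ (Fin 3))}
    (hW : IsOpen W) {β γ t₀ : ℝ} {x₀ y : EuclideanSpace ℝ (Fin 3)} {s : ℝ}
    (hx : x₀ + γ • y ∈ W) (hV : ContDiffOn ℝ 2 (V (t₀ + β * s)) W) :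
    (Δ (stPull β γ t₀ x₀ V s)) y = γ ^ 2 * (Δ (V (t₀ + β * s))) (x₀ + γ • y) := by
  obtain ⟨g', hg', hev⟩ := exists_contDiff_eventuallyEq hW hx hV
  -- the pull-backs agree near `y`
  have hA : Continuous fun w : EuclideanSpace ℝ (Fin 3) => x₀ + γ • w := by fun_prop
  have hev' : stPull β γ t₀ x₀ V s =ᶠ[𝓝 y] stPull β γ t₀ x₀ (fun _ => g') s := by
    have := hA.continuousAt.eventually hev
    filter_upwards [this] with w hw
    simp only [stPull_apply]
    exact hw.symm
  rw [(InnerProductSpace.laplacian_congr_nhds hev').self_of_nhds,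
    laplacian_stPull β γ t₀ x₀ (fun _ => g') s y hg', smul_eq_mul,
    (InnerProductSpace.laplacian_congr_nhds hev).self_of_nhds]

/-- Lebesgue measure under the affine map `y ↦ x₀ + R y` on `ℝ³`: `vol(A⁻¹ S) = R⁻³ vol S`. -/
theorem volume_preimage_affine {R : ℝ} (hR : 0 < R) (x₀ : EuclideanSpace ℝ (Fin 3)) (S : Set (EuclideanSpace ℝ (Fin 3))) :
    volume ((fun y : EuclideanSpace ℝ (Fin 3) => x₀ + R • y) ⁻¹' S) = ENNReal.ofReal ((R ^ 3)⁻¹) * volume S := by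
  have h1 : (fun y : EuclideanSpace ℝ (Fin 3) => x₀ + R • y) ⁻¹' S = (R • ·) ⁻¹' ((x₀ + ·) ⁻¹' S) := by
    ext y; simp
  rw [h1, Measure.addHaar_preimage_smul volume hR.ne', measure_preimage_add, finrank_euclideanSpace_fin,
    abs_of_pos (by positivity)]

/-- **Brick H2 (= planned stub (5b-i), now proved): affine covariance of the classical positivity propagation.** -/
theorem positivityPropagationAffine_of_factC (hPos : PositivityPropagationFactC) : PositivityPropagationAffineC := by
  intro δ T r Λ hδ hT hr hr1 hΛ
  obtain ⟨βc, hβ, hH⟩ := hPos δ T r Λ hδ hT hr hr1 hΛ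
  refine ⟨βc, hβ, ?_⟩
  intro V b U x₀ t₀ R hR hU hsub hV hb hbd hdiv hnn hsup tbar lam ht1 ht2 hlam hmeas t ht x hx
  have hR2 : 0 < R ^ 2 := by positivity
  -- the affine map and the rescaled data
  set Φ : ℝ × EuclideanSpace ℝ (Fin 3) → ℝ × EuclideanSpace ℝ (Fin 3) :=
    fun p => (t₀ + R ^ 2 * p.1, x₀ + R • p.2) with hΦ
  have hΦc : ∀ {n : WithTop ℕ∞}, ContDiff ℝ n Φ := fun {n} =>
    (contDiff_const.add (contDiff_const.mul contDiff_fst)).prodMk (contDiff_const.add (contDiff_snd.const_smul R))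
  set V' : ℝ → EuclideanSpace ℝ (Fin 3) → ℝ := stPull (R ^ 2) R t₀ x₀ V with hV'
  set b' : ℝ → EuclideanSpace ℝ (Fin 3) → EuclideanSpace ℝ (Fin 3) :=
    stPull (R ^ 2) R t₀ x₀ (fun t x => R • b t x) with hb'
  set U' : Set (ℝ × EuclideanSpace ℝ (Fin 3)) := Φ ⁻¹' U with hU'
  have hU'o : IsOpen U' := hU.preimage (hΦc (n := 0)).continuous
  -- parameter correspondence
  have htime : ∀ τ ∈ Ioo 0 T, t₀ + R ^ 2 * τ ∈ Ioo t₀ (t₀ + R ^ 2 * T) := fun τ hτ =>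
    ⟨by nlinarith [hτ.1], by nlinarith [hτ.2]⟩
  have hspace : ∀ y ∈ ball (0 : EuclideanSpace ℝ (Fin 3)) 1, x₀ + R • y ∈ ball x₀ R := by
    intro y hy
    rw [mem_ball, dist_eq_norm, add_sub_cancel_left, norm_smul, Real.norm_of_nonneg hR.le]
    have : ‖y‖ < 1 := by simpa using hy
    nlinarith
  have hsub' : Icc 0 T ×ˢ closedBall (0 : EuclideanSpace ℝ (Fin 3)) 1 ⊆ U' := by
    intro p hp
    obtain ⟨hp1, hp2⟩ := mem_prod.1 hp
    refine hsub (mem_prod.2 ⟨⟨by nlinarith [hp1.1], by nlinarith [hp1.2]⟩, ?_⟩)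
    rw [mem_closedBall, dist_eq_norm, add_sub_cancel_left, norm_smul, Real.norm_of_nonneg hR.le]
    have : ‖p.2‖ ≤ 1 := by simpa using hp2
    nlinarith
  have hmapsU : MapsTo Φ U' U := fun p hp => hp
  -- regularity of the rescaled data
  have hV'reg : ContDiffOn ℝ 2 (uncurry V') U' := by
    have e : uncurry V' = uncurry V ∘ Φ := by
      funext p; simp [hV', uncurry, stPull_apply, hΦ]
    rw [e]; exact hV.comp hΦc.contDiffOn hmapsU
  have hb'reg : ContDiffOn ℝ 1 (uncurry b') U' := by
    have e : uncurry b' = fun p => R • (uncurry b ∘ Φ) p := by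
      funext p; simp [hb', uncurry, stPull_apply, hΦ]
    rw [e]; exact (hb.comp hΦc.contDiffOn hmapsU).const_smul R
  -- pointwise hypotheses on the unit cylinder
  have hbd' : ∀ τ ∈ Ioo 0 T, ∀ y ∈ ball (0 : EuclideanSpace ℝ (Fin 3)) 1, ‖b' τ y‖ ≤ Λ := by
    intro τ hτ y hy
    have h := hbd _ (htime τ hτ) _ (hspace y hy)
    rw [hb', stPull_apply, norm_smul, Real.norm_of_nonneg hR.le]
    calc R * ‖b (t₀ + R ^ 2 * τ) (x₀ + R • y)‖ ≤ R * (Λ / R) := mul_le_mul_of_nonneg_left h hR.le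
      _ = Λ := by field_simp
  have hdiv' : ∀ τ ∈ Ioo 0 T, ∀ y ∈ ball (0 : EuclideanSpace ℝ (Fin 3)) 1,
      VectorCalculus.divergence (b' τ) y = 0 := by
    intro τ hτ y hy
    have h := hdiv _ (htime τ hτ) _ (hspace y hy)
    set Ub : EuclideanSpace ℝ (Fin 3) → EuclideanSpace ℝ (Fin 3) := fun u => b (t₀ + R ^ 2 * τ) (x₀ + u) with hUb
    have e : b' τ = fun w => R • Ub (R • w) := by
      funext w; simp [hb', hUb, stPull_apply]
    rw [e, divergence_const_smul_comp_smul]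
    have e2 : VectorCalculus.divergence Ub (R • y) = VectorCalculus.divergence (b (t₀ + R ^ 2 * τ)) (x₀ + R • y) := by
      simp only [hUb, VectorCalculus.divergence, fderiv_comp_add_left]
    rw [e2, h, mul_zero]
  have hnn' : ∀ τ ∈ Ioo 0 T, ∀ y ∈ ball (0 : EuclideanSpace ℝ (Fin 3)) 1, 0 ≤ V' τ y := by
    intro τ hτ y hy
    rw [hV', stPull_apply]
    exact hnn _ (htime τ hτ) _ (hspace y hy)
  have hsup' : ∀ τ ∈ Ioo 0 T, ∀ y ∈ ball (0 : EuclideanSpace ℝ (Fin 3)) 1,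
      0 ≤ deriv (fun τ' => V' τ' y) τ - (Δ (V' τ)) y + ⟪b' τ y, gradient (V' τ) y⟫_ℝ := by
    intro τ hτ y hy
    have ht' := htime τ hτ
    have hx' := hspace y hy
    have h := hsup _ ht' _ hx'
    -- time derivative
    have e1 : deriv (fun τ' => V' τ' y) τ = R ^ 2 * deriv (fun s => V s (x₀ + R • y)) (t₀ + R ^ 2 * τ) := by
      have := timeDeriv_stPull (R ^ 2) R t₀ x₀ V τ y
      simpa [timeDeriv, hV', smul_eq_mul] using this
    -- Laplacian (local version: `V (t)` is `C²` on the open slice of `U`)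
    have hWo : IsOpen {w : EuclideanSpace ℝ (Fin 3) | (t₀ + R ^ 2 * τ, w) ∈ U} :=
      hU.preimage (Continuous.prodMk_right _)
    have hxW : x₀ + R • y ∈ {w : EuclideanSpace ℝ (Fin 3) | (t₀ + R ^ 2 * τ, w) ∈ U} :=
      hsub (mem_prod.2 ⟨⟨le_of_lt ht'.1, le_of_lt ht'.2⟩, ball_subset_closedBall hx'⟩)
    have hVslice : ContDiffOn ℝ 2 (V (t₀ + R ^ 2 * τ)) {w | (t₀ + R ^ 2 * τ, w) ∈ U} := by
      have e : V (t₀ + R ^ 2 * τ) = uncurry V ∘ fun w => (t₀ + R ^ 2 * τ, w) := rfl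
      rw [e]
      exact hV.comp (contDiff_const.prodMk contDiff_id).contDiffOn fun w hw => hw
    have e2 : (Δ (V' τ)) y = R ^ 2 * (Δ (V (t₀ + R ^ 2 * τ))) (x₀ + R • y) := by
      rw [hV']
      exact laplacian_stPull_of_contDiffOn hWo hxW hVslice
    -- gradient and drift
    have e3 : gradient (V' τ) y = R • gradient (V (t₀ + R ^ 2 * τ)) (x₀ + R • y) := by
      rw [hV']; exact gradient_stPull (R ^ 2) R t₀ x₀ V τ y
    have e4 : b' τ y = R • b (t₀ + R ^ 2 * τ) (x₀ + R • y) := by simp [hb', stPull_apply]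
    rw [e1, e2, e3, e4, real_inner_smul_left, real_inner_smul_right]
    have : R ^ 2 * (deriv (fun s => V s (x₀ + R • y)) (t₀ + R ^ 2 * τ) - (Δ (V (t₀ + R ^ 2 * τ))) (x₀ + R • y)
        + ⟪b (t₀ + R ^ 2 * τ) (x₀ + R • y), gradient (V (t₀ + R ^ 2 * τ)) (x₀ + R • y)⟫_ℝ) ≥ 0 :=
      mul_nonneg hR2.le h
    nlinarith [this]
  -- the occupied level at the rescaled time `τ̄ = (t̄ − t₀)/R²`
  set τbar : ℝ := (tbar - t₀) / R ^ 2 with hτbar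
  have hτ1 : 0 < τbar := div_pos (by linarith) hR2
  have hτ2 : τbar < T / 3 := by rw [hτbar, div_lt_iff₀ hR2]; nlinarith
  have htb : t₀ + R ^ 2 * τbar = tbar := by rw [hτbar]; field_simp; ring
  have hmeas' : ENNReal.ofReal δ ≤
      volume {y : EuclideanSpace ℝ (Fin 3) | y ∈ ball (0 : EuclideanSpace ℝ (Fin 3)) 1 ∧ lam ≤ V' τbar y} := by
    have e : {y : EuclideanSpace ℝ (Fin 3) | y ∈ ball (0 : EuclideanSpace ℝ (Fin 3)) 1 ∧ lam ≤ V' τbar y} =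
        (fun y : EuclideanSpace ℝ (Fin 3) => x₀ + R • y) ⁻¹' {x | x ∈ ball x₀ R ∧ lam ≤ V tbar x} := by
      ext y
      simp only [mem_setOf_eq, mem_preimage, hV', stPull_apply, htb, mem_ball, dist_eq_norm,
        add_sub_cancel_left, norm_smul, Real.norm_of_nonneg hR.le, sub_zero]
      constructor
      · rintro ⟨h1, h2⟩; exact ⟨(mul_lt_iff_lt_one_right hR).2 h1, h2⟩
      · rintro ⟨h1, h2⟩; exact ⟨(mul_lt_iff_lt_one_right hR).1 h1, h2⟩
    rw [e, volume_preimage_affine hR]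
    have hR3 : 0 < R ^ 3 := by positivity
    calc ENNReal.ofReal δ = ENNReal.ofReal ((R ^ 3)⁻¹) * ENNReal.ofReal (δ * R ^ 3) := by
          rw [← ENNReal.ofReal_mul (by positivity)]
          congr 1; field_simp
      _ ≤ ENNReal.ofReal ((R ^ 3)⁻¹) * volume {x | x ∈ ball x₀ R ∧ lam ≤ V tbar x} :=
          mul_le_mul_right hmeas _
  -- apply the unit-cylinder fact at `(τ, y) = ((t − t₀)/R², R⁻¹ (x − x₀))`
  set τ : ℝ := (t - t₀) / R ^ 2 with hτ
  set y : EuclideanSpace ℝ (Fin 3) := R⁻¹ • (x - x₀) with hy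
  have hτI : τ ∈ Ioo (T / 2) T := by
    obtain ⟨hta, htb'⟩ := ht
    refine ⟨?_, ?_⟩
    · rw [hτ, lt_div_iff₀ hR2]
      have : T / 2 * R ^ 2 = R ^ 2 * T / 2 := by ring
      rw [this]; linarith
    · rw [hτ, div_lt_iff₀ hR2]
      have : T * R ^ 2 = R ^ 2 * T := by ring
      rw [this]; linarith
  have hyB : y ∈ ball (0 : EuclideanSpace ℝ (Fin 3)) r := by
    rw [mem_ball, dist_zero_right, hy, norm_smul, Real.norm_of_nonneg (inv_nonneg.2 hR.le)]
    have hxd : ‖x - x₀‖ < r * R := by rwa [mem_ball, dist_eq_norm] at hx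
    rw [inv_mul_lt_iff₀ hR]; linarith
  have key := hH V' b' U' hU'o hsub' hV'reg hb'reg hbd' hdiv' hnn' hsup' τbar lam hτ1 hτ2 hlam hmeas' τ hτI y hyB
  have e : V' τ y = V t x := by
    rw [hV', stPull_apply, hτ, hy, smul_smul, mul_inv_cancel₀ hR.ne', one_smul, add_sub_cancel]
    congr 1; field_simp; ring
  rw [e] at key
  exact key

end Summit.NavierStokesRegularity.NavierStokesRegularity.Theorems.AxisTwistDoorAveragedConeLiouvillePositivityAffine

end
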